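import Mathlib.Geometry.Manifold.Instances.Real
import Literature.Geometry.Manifold.AtlasOn
import Literature.Topology.PlaneTopology.AnnulusTheorem
import HarnessLib

/-!
# Smooth structures on plane domains: straightening over a disc (`0`-handle smoothing)

Topic `Literature/Topology/FourManifolds` (smoothing theory of surfaces; brick of the `n = 2`
leaf — Radó 1925 / Kerékjártó: every topological surface admits a smooth structure — of the
named fact `Literature.Topology.FourManifolds.exists_chartedSpace_isManifold_of_le_three`,
spc4.S33). A. Hatcher, *The Kirby torus trick for surfaces*, arXiv:1312.3518, proves Thm. A
("Every topological surface has a smooth structure") from the **Handle smoothing theorem (0)**: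
"An embedding `ℝ² → S` can be isotoped to be a smooth embedding in a neighborhood of the origin,
staying fixed outside a larger neighborhood of the origin", which he obtains by the torus trick.
Here the same statement — in the static form that suffices for Thm. A, and for smooth structures
on plane domains — is proved from the two-dimensional **annulus theorem** of the tree
(`Literature.Topology.PlaneTopology.annulus_theorem`, `exists_homeomorph_extend_closedBall`)
instead of the torus trick:

* the set-up (`planeGroupoid = contDiffGroupoid ∞ (𝓡 2)`, `PlaneAtlas W` = an
  `Literature.Geometry.Manifold.AtlasOn` of smoothly compatible charts `ℂ ⇀ ℝ²` on the open set
  `W ⊆ ℂ`, the standard chart `stdChart = cι : ℂ ≃L[ℝ] ℝ²`, the standard structure `stdAtlas O`,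
  smooth charts `IsSmoothChart`, and `agreeOn_stdAtlas_of_isSmoothChart` /
  `isSmoothChart_restr_of_agreeOn_stdAtlas`: an atlas is standard over `O` iff its charts are
  smooth there);
* `pullback_agreeOn_stdAtlas` — **pulling back along a map which reads as a diffeomorphism in a
  chart of `𝒮` yields the standard structure**; `pullback_agreeOn_of_eqOn_id` — pulling back
  along a map which is the identity over `O` changes nothing over `O`;
* `exists_homeomorph_pullback_agreeOn_stdAtlas` — **`0`-handle smoothing, round form**: for a
  smooth atlas `𝒮` on `W ⊇ {‖z‖ ≤ 2}` there is a homeomorphism `Φ` of `ℂ`, the identity on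
  `{‖z‖ ≥ 2}`, with `Φ*𝒮` standard over the unit disc and equal to `𝒮` off `{‖z‖ ≤ 2}` (`Φ` is a
  tiny `𝒮`-coordinate disc map on the unit disc, composed with `conj` if orientations disagree,
  and the homeomorphism of `exists_homeomorph_extend_closedBall` in between);
* `exists_homeomorph_uniformize_pair` — a nested pair of Jordan domains `closure P₁ ⊆ P₂` is the
  image of the round pair under a homeomorphism of `ℂ` which is a `C^∞` diffeomorphism of `P₁`
  onto the unit disc (Riemann map + Carathéodory inside, annulus theorem in between);
* `exists_homeomorph_pullback_agreeOn_stdAtlas_jordan` — **`0`-handle smoothing over an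
  arbitrary Jordan domain**: `Φ` the identity off `closure P₂`, `Φ*𝒮` standard over `P₁` and
  equal to `𝒮` off `closure P₂`.

Everything is proved; no named facts. Mathlib has no smoothing theory (and no Jordan curve
theorem); its `ChartedSpace`/`contDiffGroupoid` API is used throughout.

## References

* A. Hatcher, *The Kirby torus trick for surfaces*, arXiv:1312.3518 (2013), Handle smoothing
  theorem (0) and proof of Thm. A.
* E. E. Moise, *Geometric topology in dimensions 2 and 3*, GTM 47 (1977), Ch. 8 (Radó's theorem).
-/

noncomputable section

namespace Literature.Topology.FourManifolds

open Set Metric OpenPartialHomeomorph Filter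
open scoped Manifold _root_.Topology ContDiff
open Literature.Geometry.Manifold (AtlasOn)
open Literature.Geometry.Manifold.AtlasOn
open Literature.Probability.RandomPlanarGeometry (JordanDomain)
open Literature.Probability.RandomPlanarGeometry.JordanDomain
open Literature.Topology.PlaneTopology

/-- Local notation for the model plane `ℝ²`. -/
local notation "𝔼₂" => EuclideanSpace ℝ (Fin 2)

/-! ### Smooth atlases in the plane: the model, the standard structure -/

/-- The structure groupoid of `C^∞` local diffeomorphisms of `ℝ²` (transition maps of smooth
surfaces modelled on `𝓡 2`). [folklore] -/
abbrev planeGroupoid : StructureGroupoid 𝔼₂ := contDiffGroupoid ∞ (𝓡 2)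

/-- A **smooth atlas on an open subset `W` of the plane**: an `AtlasOn` for the groupoid of
`C^∞` local diffeomorphisms of `ℝ²` (a smooth structure on `W` compatible with its topology).
[folklore] -/
abbrev PlaneAtlas (W : Set ℂ) := AtlasOn planeGroupoid W

/-- Membership in the `C^n` groupoid of a Euclidean model space: both the map and its inverse
are `C^n` on source and target. [folklore] -/
theorem mem_contDiffGroupoid_euclidean_iff {m : ℕ} {n : WithTop ℕ∞}
    {e : OpenPartialHomeomorph (EuclideanSpace ℝ (Fin m)) (EuclideanSpace ℝ (Fin m))} :
    e ∈ contDiffGroupoid n (𝓡 m) ↔ ContDiffOn ℝ n e e.source ∧ ContDiffOn ℝ n e.symm e.target := by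
  rw [contDiffGroupoid, mem_groupoid_of_pregroupoid]
  simp only [contDiffPregroupoid, modelWithCornersSelf_coe, modelWithCornersSelf_coe_symm,
    CompTriple.comp_eq, preimage_id_eq, range_id, inter_univ]
  rfl

/-- The real-linear isometry `ℂ ≅ ℝ²`, `z ↦ (re z, im z)`. [folklore] -/
def cι : ℂ ≃L[ℝ] 𝔼₂ := Complex.orthonormalBasisOneI.repr.toContinuousLinearEquiv

/-- `cι` is an isometry: `‖cι z‖ = ‖z‖`. [folklore] -/
@[simp] theorem norm_cι (z : ℂ) : ‖cι z‖ = ‖z‖ :=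
  Complex.orthonormalBasisOneI.repr.norm_map z

/-- `cι⁻¹` is an isometry. [folklore] -/
@[simp] theorem norm_cι_symm (x : 𝔼₂) : ‖cι.symm x‖ = ‖x‖ := by
  conv_rhs => rw [← cι.apply_symm_apply x]
  rw [norm_cι]

/-- The **standard chart** of the plane: `cι` as a partial homeomorphism on `univ`. [folklore] -/
def stdChart : OpenPartialHomeomorph ℂ 𝔼₂ := cι.toHomeomorph.toOpenPartialHomeomorph

/-- The standard chart is `cι`. [folklore] -/
@[simp] theorem stdChart_apply (z : ℂ) : stdChart z = cι z := rfl

/-- The inverse of the standard chart is `cι⁻¹`. [folklore] -/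
@[simp] theorem stdChart_symm_apply (x : 𝔼₂) : stdChart.symm x = cι.symm x := rfl

/-- The standard chart is defined everywhere. [folklore] -/
@[simp] theorem stdChart_source : stdChart.source = univ := rfl

/-- The standard chart is onto the model. [folklore] -/
@[simp] theorem stdChart_target : stdChart.target = univ := rfl

/-- Restrictions of the standard chart are still `cι` as maps. [folklore] -/
@[simp] theorem stdChart_restr_apply (O : Set ℂ) (z : ℂ) : stdChart.restr O z = cι z := rfl

/-- Inverses of restrictions of the standard chart are still `cι⁻¹` as maps. [folklore] -/
@[simp] theorem stdChart_restr_symm_apply (O : Set ℂ) (x : 𝔼₂) : (stdChart.restr O).symm x = cι.symm x := rfl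

/-- **The standard smooth structure on an open subset of the plane**: the atlas consisting of
the restriction of the standard chart. [folklore] -/
def stdAtlas (O : Set ℂ) (hO : IsOpen O) : PlaneAtlas O :=
  (((AtlasOn.singleton stdChart : PlaneAtlas stdChart.source).restrict O hO).copy (by simp))

/-- The charts of the standard atlas: the single chart `stdChart|O`. [folklore] -/
@[simp] theorem stdAtlas_charts (O : Set ℂ) (hO : IsOpen O) : (stdAtlas O hO).charts = {stdChart.restr O} := by
  simp [stdAtlas]

/-! ### Smooth charts -/

/-- A partial homeomorphism `f : ℂ ⇀ ℝ²` is a **smooth chart** (for the standard structure) when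
`f` is `C^∞` on its source and `f⁻¹` on its target. [folklore] -/
def IsSmoothChart (f : OpenPartialHomeomorph ℂ 𝔼₂) : Prop :=
  ContDiffOn ℝ ∞ f f.source ∧ ContDiffOn ℝ ∞ f.symm f.target

/-- **A smooth chart is compatible with the standard chart**: `stdChart⁻¹ ≫ f` and
`f⁻¹ ≫ stdChart` are `C^∞` local diffeomorphisms of `ℝ²`. [folklore] -/
theorem IsSmoothChart.compat {f : OpenPartialHomeomorph ℂ 𝔼₂} (hf : IsSmoothChart f) :
    stdChart.symm ≫ₕ f ∈ planeGroupoid ∧ f.symm ≫ₕ stdChart ∈ planeGroupoid := by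
  have h1 : ContDiffOn ℝ ∞ (stdChart.symm ≫ₕ f) (stdChart.symm ≫ₕ f).source := by
    have : ((stdChart.symm ≫ₕ f) : 𝔼₂ → 𝔼₂) = f ∘ cι.symm := rfl
    rw [this]
    refine hf.1.comp cι.symm.contDiff.contDiffOn fun x hx => ?_
    simpa [trans_source] using hx
  have h2 : ContDiffOn ℝ ∞ (stdChart.symm ≫ₕ f).symm (stdChart.symm ≫ₕ f).target := by
    have : (((stdChart.symm ≫ₕ f).symm) : 𝔼₂ → 𝔼₂) = cι ∘ f.symm := rfl
    rw [this]
    refine cι.contDiff.comp_contDiffOn (hf.2.mono fun x hx => ?_)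
    simp only [trans_target, symm_target, stdChart_source, preimage_univ, inter_univ] at hx
    exact hx
  have h3 : ContDiffOn ℝ ∞ (f.symm ≫ₕ stdChart) (f.symm ≫ₕ stdChart).source := by
    have : ((f.symm ≫ₕ stdChart) : 𝔼₂ → 𝔼₂) = cι ∘ f.symm := rfl
    rw [this]
    refine cι.contDiff.comp_contDiffOn (hf.2.mono fun x hx => ?_)
    simp only [trans_source, symm_source, stdChart_source, preimage_univ, inter_univ] at hx
    exact hx
  have h4 : ContDiffOn ℝ ∞ (f.symm ≫ₕ stdChart).symm (f.symm ≫ₕ stdChart).target := by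
    have : (((f.symm ≫ₕ stdChart).symm) : 𝔼₂ → 𝔼₂) = f ∘ cι.symm := by
      ext x; rfl
    rw [this]
    refine hf.1.comp cι.symm.contDiff.contDiffOn fun x hx => ?_
    simp only [trans_target, stdChart_target, mem_inter_iff, mem_univ, true_and,
      mem_preimage, stdChart_symm_apply] at hx
    exact hx
  exact ⟨mem_contDiffGroupoid_euclidean_iff.2 ⟨h1, h2⟩, mem_contDiffGroupoid_euclidean_iff.2 ⟨h3, h4⟩⟩

/-- Restrictions of smooth charts to open sets are smooth charts. [folklore] -/
theorem IsSmoothChart.restr {f : OpenPartialHomeomorph ℂ 𝔼₂} (hf : IsSmoothChart f) {s : Set ℂ} (hs : IsOpen s) :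
    IsSmoothChart (f.restr s) :=
  ⟨hf.1.mono (by rw [restr_source' _ _ hs]; exact inter_subset_left),
   hf.2.mono (by rw [restr_target]; exact inter_subset_left)⟩

/-- The standard chart is a smooth chart. [folklore] -/
theorem isSmoothChart_stdChart : IsSmoothChart stdChart :=
  ⟨cι.contDiff.contDiffOn, cι.symm.contDiff.contDiffOn⟩

/-- Restricting the first chart does not change a transition map whose second chart already
lives over the restricting open set. [folklore] -/
theorem restr_symm_trans_eqOnSource {X Y Z : Type*} [TopologicalSpace X] [TopologicalSpace Y]
    [TopologicalSpace Z] (e : OpenPartialHomeomorph X Y) (T : OpenPartialHomeomorph X Z) {s : Set X}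
    (hs : IsOpen s) (hT : T.source ⊆ s) : (e.restr s).symm ≫ₕ T ≈ e.symm ≫ₕ T := by
  constructor
  · ext y
    simp only [trans_source, symm_source, restr_target, mem_inter_iff, mem_preimage, interior_eq_iff_isOpen.2 hs]
    constructor
    · rintro ⟨⟨hy, -⟩, hyT⟩; exact ⟨hy, hyT⟩
    · rintro ⟨hy, hyT⟩; exact ⟨⟨hy, hT hyT⟩, hyT⟩
  · intro y _; rfl

/-- **Smoothness of the restricted charts implies agreement with the standard structure** over
an open set `O`. [folklore] -/
theorem agreeOn_stdAtlas_of_isSmoothChart {W O : Set ℂ} (𝒮 : PlaneAtlas W) (hO : IsOpen O)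
    (h : ∀ e ∈ 𝒮.charts, IsSmoothChart (e.restr O)) : 𝒮.AgreeOn (stdAtlas O hO) O := by
  intro e he e' he'
  rw [stdAtlas_charts] at he'
  rw [mem_singleton_iff.1 he']
  obtain ⟨h1, h2⟩ := (h e he).compat
  refine ⟨?_, ?_⟩
  · have h3 : (e.restr O).symm ≫ₕ (stdChart.restr O).restr O ∈ planeGroupoid :=
      planeGroupoid.symm_trans_restr_mem (planeGroupoid.symm_trans_restr_mem h2 hO) hO
    refine planeGroupoid.mem_of_eqOnSource h3 (Setoid.symm (restr_symm_trans_eqOnSource e _ hO ?_))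
    rw [restr_source' _ _ hO, restr_source' _ _ hO]
    exact inter_subset_right
  · simpa [restr_univ] using planeGroupoid.restr_symm_trans_restr_mem h1 hO isOpen_univ

/-- Conversely, **charts of an atlas agreeing with the standard structure over `O` are smooth
charts after restriction to `O`**. [folklore] -/
theorem isSmoothChart_restr_of_agreeOn_stdAtlas {W O : Set ℂ} {𝒮 : PlaneAtlas W} (hO : IsOpen O)
    (h : 𝒮.AgreeOn (stdAtlas O hO) O) {e : OpenPartialHomeomorph ℂ 𝔼₂} (he : e ∈ 𝒮.charts) :
    IsSmoothChart (e.restr O) := by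
  obtain ⟨h1, h2⟩ := h e he (stdChart.restr O) (by simp)
  -- `h2 : (stdChart|O)⁻¹ ≫ e|O ∈ G` gives smoothness of `e` on `e.source ∩ O`
  obtain ⟨h2a, h2b⟩ := mem_contDiffGroupoid_euclidean_iff.1 h2
  refine ⟨?_, ?_⟩
  · -- `e = (e|O ∘ cι⁻¹) ∘ cι` on `e.source ∩ O`
    have key : ContDiffOn ℝ ∞ (((stdChart.restr O).symm ≫ₕ e.restr O) ∘ cι) (e.restr O).source := by
      refine h2a.comp cι.contDiff.contDiffOn fun x hx => ?_
      rw [restr_source' _ _ hO] at hx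
      simp only [trans_source, symm_source, restr_target, stdChart_target, univ_inter, mem_inter_iff, mem_preimage,
        interior_eq_iff_isOpen.2 hO, stdChart_restr_symm_apply, stdChart_symm_apply,
        ContinuousLinearEquiv.symm_apply_apply, restr_source' _ _ hO]
      exact ⟨hx.2, hx⟩
    refine key.congr fun x _ => ?_
    simp only [Function.comp_apply, coe_trans, restr_apply, stdChart_restr_symm_apply,
      ContinuousLinearEquiv.symm_apply_apply]
  · -- `e⁻¹ = cι⁻¹ ∘ (cι ∘ e⁻¹)` on `(e|O).target`
    have key : ContDiffOn ℝ ∞ (cι.symm ∘ ((stdChart.restr O).symm ≫ₕ e.restr O).symm) (e.restr O).target := by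
      refine cι.symm.contDiff.comp_contDiffOn (h2b.mono fun x hx => ?_)
      simp only [trans_target, symm_target, restr_source' _ _ hO, stdChart_source, univ_inter, mem_inter_iff,
        mem_preimage]
      rw [restr_target] at hx
      refine ⟨hx, ?_⟩
      have := hx.2
      rw [mem_preimage, interior_eq_iff_isOpen.2 hO] at this
      exact this
    refine key.congr fun x _ => ?_
    simp only [Function.comp_apply, coe_trans_symm, symm_symm, stdChart_restr_apply,
      ContinuousLinearEquiv.symm_apply_apply]

/-! ### Pull-backs and the standard structure -/

/-- **Pulling back along a map that reads as a diffeomorphism in a chart gives the standard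
structure.** Let `𝒮` be a smooth atlas on `W`, `ψ` one of its charts, `Φ : ℂ ⇀ ℂ` a partial
homeomorphism and `P` an open set with `P ⊆ Φ.source`, `Φ(P) ⊆ ψ.source`, such that the chart
`(Φ ≫ ψ)|P` is a smooth chart (i.e. `ψ ∘ Φ` is a `C^∞` diffeomorphism of `P` onto an open subset
of `ℝ²`). Then the pulled-back atlas `Φ*𝒮` agrees with the standard structure over `P`.
[folklore] -/
theorem pullback_agreeOn_stdAtlas {W : Set ℂ} (𝒮 : PlaneAtlas W) {ψ : OpenPartialHomeomorph ℂ 𝔼₂}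
    (hψ : ψ ∈ 𝒮.charts) (Φ : OpenPartialHomeomorph ℂ ℂ) {P : Set ℂ} (hP : IsOpen P) (hPΦ : P ⊆ Φ.source)
    (hPψ : Φ '' P ⊆ ψ.source) (hsm : IsSmoothChart ((Φ ≫ₕ ψ).restr P)) :
    (𝒮.pullback Φ).AgreeOn (stdAtlas P hP) P := by
  set m := (Φ ≫ₕ ψ).restr P with hm
  have hmsrc : m.source = P := by
    rw [hm, restr_source' _ _ hP, trans_source]
    ext x; constructor
    · exact fun hx => hx.2
    · exact fun hx => ⟨⟨hPΦ hx, hPψ (mem_image_of_mem _ hx)⟩, hx⟩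
  obtain ⟨hm1, hm2⟩ := hsm.compat
  rintro _ ⟨e, he, rfl⟩ e' he'
  rw [stdAtlas_charts] at he'
  rw [mem_singleton_iff.1 he']
  have hce : (Φ ≫ₕ ψ).symm ≫ₕ (Φ ≫ₕ e) ∈ planeGroupoid :=
    (𝒮.pullback Φ).compatible _ (mem_image_of_mem _ hψ) _ (mem_image_of_mem _ he)
  have hec : (Φ ≫ₕ e).symm ≫ₕ (Φ ≫ₕ ψ) ∈ planeGroupoid :=
    (𝒮.pullback Φ).compatible _ (mem_image_of_mem _ he) _ (mem_image_of_mem _ hψ)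
  refine ⟨planeGroupoid.symm_trans_mem_of_forall fun x hx => ⟨m, ?_, ?_, ?_⟩,
    planeGroupoid.symm_trans_mem_of_forall fun x hx => ⟨m, ?_, ?_, ?_⟩⟩
  · rw [hmsrc]; rw [restr_source' _ _ hP] at hx; exact hx.2.2
  · exact planeGroupoid.symm_trans_restr_mem hec hP
  · -- `m⁻¹ ≫ (stdChart|P)|P`, from `m⁻¹ ≫ stdChart`
    exact planeGroupoid.symm_trans_restr_mem (planeGroupoid.symm_trans_restr_mem hm2 hP) hP
  · rw [hmsrc]; rw [restr_source' _ _ hP] at hx; exact hx.1.2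
  · simpa [restr_univ] using planeGroupoid.restr_symm_trans_restr_mem hm1 hP isOpen_univ
  · exact planeGroupoid.restr_symm_trans_restr_mem hce hP hP

/-- **Pulling back along a map which is the identity on an open set `O` does not change the
structure over `O`.** [folklore] -/
theorem pullback_agreeOn_of_eqOn_id {W : Set ℂ} (𝒮 : PlaneAtlas W) (Φ : OpenPartialHomeomorph ℂ ℂ)
    {O : Set ℂ} (hO : IsOpen O) (hOΦ : O ⊆ Φ.source) (hid : EqOn Φ id O) :
    (𝒮.pullback Φ).AgreeOn 𝒮 O := by
  have hid' : ∀ x ∈ O, Φ x = x := fun x hx => hid hx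
  have hΦO' : ∀ x ∈ O, x ∈ Φ.target := fun x hx => by
    rw [← hid' x hx]; exact Φ.map_source (hOΦ hx)
  have hΦO : ∀ x ∈ O, Φ.symm x = x := fun x hx => by
    conv_lhs => rw [← hid' x hx]
    exact Φ.left_inv (hOΦ hx)
  -- if `Φ⁻¹ z ∈ O` for `z ∈ Φ.target` then `z = Φ (Φ⁻¹ z) = Φ⁻¹ z`
  have hfix : ∀ z ∈ Φ.target, Φ.symm z ∈ O → Φ.symm z = z := fun z hz hzO => by
    have h1 := hid' _ hzO
    rw [Φ.right_inv hz] at h1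
    exact h1.symm
  -- the transition maps over `O` are those of `𝒮`
  have key : ∀ e e' : OpenPartialHomeomorph ℂ 𝔼₂, (Φ ≫ₕ e).symm ≫ₕ e'.restr O ≈ e.symm ≫ₕ e'.restr O := by
    intro e e'
    constructor
    · ext y
      simp only [trans_source, symm_source, trans_target, coe_trans_symm, Function.comp_apply, mem_inter_iff,
        mem_preimage, restr_source' _ _ hO]
      constructor
      · rintro ⟨⟨hy, hyt⟩, he', hyO⟩
        rw [hfix _ hyt hyO] at he' hyO
        exact ⟨hy, he', hyO⟩
      · rintro ⟨hy, he', hyO⟩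
        refine ⟨⟨hy, hΦO' _ hyO⟩, ?_, ?_⟩
        · rw [hΦO _ hyO]; exact he'
        · rw [hΦO _ hyO]; exact hyO
    · intro y hy
      simp only [trans_source, symm_source, trans_target, coe_trans_symm, Function.comp_apply, mem_inter_iff,
        mem_preimage, restr_source' _ _ hO] at hy
      obtain ⟨⟨-, hyt⟩, -, hyO⟩ := hy
      simp only [coe_trans, coe_trans_symm, Function.comp_apply, restr_apply, hfix _ hyt hyO]
  have h1 : ∀ e ∈ 𝒮.charts, ∀ e' ∈ 𝒮.charts, (Φ ≫ₕ e).symm ≫ₕ e'.restr O ∈ planeGroupoid := fun e he e' he' =>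
    planeGroupoid.mem_of_eqOnSource (planeGroupoid.symm_trans_restr_mem (𝒮.compatible e he e' he') hO) (key e e')
  rintro _ ⟨e, he, rfl⟩ e' he'
  refine ⟨h1 e he e' he', ?_⟩
  -- second direction by symmetry and restriction
  have h2 : (e'.restr O).symm ≫ₕ (Φ ≫ₕ e).restr O ∈ planeGroupoid :=
    planeGroupoid.symm_trans_restr_mem (planeGroupoid.symm_trans_mem_symm (h1 e he e' he')) hO
  refine planeGroupoid.mem_of_eqOnSource h2 (Setoid.symm (restr_symm_trans_eqOnSource e' _ hO ?_))
  rw [restr_source' _ _ hO]; exact inter_subset_right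

/-- **Functoriality of pull-backs**: pulling back along `φ` and then along `φ'` is pulling back
along `φ' ≫ φ` (same charts). [folklore] -/
theorem pullback_pullback_charts {X X' X'' : Type*} [TopologicalSpace X] [TopologicalSpace X']
    [TopologicalSpace X''] {H : Type*} [TopologicalSpace H] {G : StructureGroupoid H} [ClosedUnderRestriction G]
    {W : Set X} (𝒜 : AtlasOn G W) (φ : OpenPartialHomeomorph X' X) (φ' : OpenPartialHomeomorph X'' X') :
    ((𝒜.pullback φ).pullback φ').charts = (𝒜.pullback (φ' ≫ₕ φ)).charts := by
  simp only [pullback_charts, image_image, trans_assoc]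

/-- Agreement only depends on the sets of charts. [folklore] -/
theorem agreeOn_iff_of_charts_eq {X : Type*} [TopologicalSpace X] {H : Type*} [TopologicalSpace H]
    {G : StructureGroupoid H} {U U' V V' : Set X} {𝒜 : AtlasOn G U} {𝒜' : AtlasOn G U'} {ℬ : AtlasOn G V}
    {ℬ' : AtlasOn G V'} (h𝒜 : 𝒜.charts = 𝒜'.charts) (hℬ : ℬ.charts = ℬ'.charts) (O : Set X) :
    𝒜.AgreeOn ℬ O ↔ 𝒜'.AgreeOn ℬ' O := by
  unfold AtlasOn.AgreeOn
  rw [h𝒜, hℬ]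

/-! ### Straightening a smooth structure on a disc (`0`-handle smoothing) -/

/-- The real-linear structure of complex conjugation: it is `C^∞`. [folklore] -/
theorem contDiff_conj : ContDiff ℝ ∞ (starRingEnd ℂ : ℂ → ℂ) := Complex.conjCLE.contDiff

/-- **Straightening a smooth structure over the unit disc** (the `0`-handle smoothing lemma,
A. Hatcher, *The Kirby torus trick for surfaces*, arXiv:1312.3518, "Handle smoothing theorem
(0)", here from the annulus theorem instead of the torus trick). Let `𝒮` be a smooth atlas on an
open `W ⊆ ℂ` containing the closed disc of radius `2`. There is a homeomorphism `Φ` of `ℂ`, the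
identity on `{‖z‖ ≥ 2}`, such that the pulled-back structure `Φ*𝒮` is the standard smooth
structure over the open unit disc and is `𝒮` outside the closed disc of radius `2`: on the unit
disc `Φ` is a tiny `𝒮`-coordinate disc map (composed with `conj` if needed), in between a
homeomorphism supplied by `exists_homeomorph_extend_closedBall`. [folklore] -/
theorem exists_homeomorph_pullback_agreeOn_stdAtlas {W : Set ℂ} (𝒮 : PlaneAtlas W) (hW : closedBall (0 : ℂ) 2 ⊆ W) :
    ∃ Φ : ℂ ≃ₜ ℂ, (∀ z, 2 ≤ ‖z‖ → Φ z = z) ∧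
      (𝒮.pullback Φ.toOpenPartialHomeomorph).AgreeOn (stdAtlas (ball 0 1) isOpen_ball) (ball 0 1) ∧
      (𝒮.pullback Φ.toOpenPartialHomeomorph).AgreeOn 𝒮 (closedBall 0 2)ᶜ := by
  -- a chart at the origin and a small coordinate disc inside the disc of radius `2`
  obtain ⟨ψ, hψ, h0⟩ := 𝒮.cover 0 (hW (by simp))
  set c : 𝔼₂ := ψ 0 with hc
  have hnhds : ψ.target ∩ ψ.symm ⁻¹' ball (0 : ℂ) 2 ∈ 𝓝 c := by
    refine (ψ.isOpen_inter_preimage_symm isOpen_ball).mem_nhds ⟨ψ.map_source h0, ?_⟩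
    show ψ.symm (ψ 0) ∈ ball (0 : ℂ) 2
    rw [ψ.left_inv h0]; simp
  obtain ⟨ρ', hρ', hball⟩ := Metric.mem_nhds_iff.1 hnhds
  set ρ : ℝ := ρ' / 2 with hρ
  have hρ0 : 0 < ρ := half_pos hρ'
  have hcb : closedBall c ρ ⊆ ψ.target ∩ ψ.symm ⁻¹' ball (0 : ℂ) 2 :=
    (closedBall_subset_ball (half_lt_self hρ')).trans hball
  -- the coordinate disc map `g z = ψ⁻¹ (c + ρ z)`
  set a : ℂ → 𝔼₂ := fun z => c + (ρ : ℝ) • cι z with ha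
  have hac : Continuous a := continuous_const.add (cι.continuous.const_smul ρ)
  have ha_mem : ∀ z, ‖z‖ ≤ 1 → a z ∈ closedBall c ρ := fun z hz => by
    rw [mem_closedBall, dist_eq_norm, ha]
    simp only [add_sub_cancel_left, norm_smul, Real.norm_eq_abs, abs_of_pos hρ0, norm_cι]
    nlinarith
  have ha_ball : ∀ z, ‖z‖ < 1 → a z ∈ ball c ρ := fun z hz => by
    rw [mem_ball, dist_eq_norm, ha]
    simp only [add_sub_cancel_left, norm_smul, Real.norm_eq_abs, abs_of_pos hρ0, norm_cι]
    nlinarith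
  have ha_inj : Function.Injective a := fun z w h => by
    have : (ρ : ℝ) • cι z = (ρ : ℝ) • cι w := add_left_cancel h
    exact cι.injective (smul_right_injective _ hρ0.ne' this)
  set g : ℂ → ℂ := fun z => ψ.symm (a z) with hg
  have hgc : ContinuousOn g (closedBall 0 1) := by
    refine ψ.continuousOn_symm.comp hac.continuousOn fun z hz => (hcb (ha_mem z (mem_closedBall_zero_iff.1 hz))).1
  have hgi : InjOn g (closedBall 0 1) := fun z hz w hw h => by
    have hz' := (hcb (ha_mem z (mem_closedBall_zero_iff.1 hz))).1
    have hw' := (hcb (ha_mem w (mem_closedBall_zero_iff.1 hw))).1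
    exact ha_inj (ψ.symm.injOn (by simpa using hz') (by simpa using hw') h)
  -- the Jordan domain bounded by the coordinate circle
  have hcl : closure unitDisc.carrier = closedBall (0 : ℂ) 1 := by
    rw [carrier_unitDisc, closure_ball _ one_ne_zero]
  set D : JordanDomain := unitDisc.image g (hcl ▸ hgc) (hcl ▸ hgi) with hD
  have hDc : D.carrier = g '' ball 0 1 := by rw [hD, carrier_image, carrier_unitDisc]
  have hDcl : closure D.carrier = g '' closedBall 0 1 := by
    rw [hD, closure_carrier_image, hcl]
  have hDfr : frontier D.carrier = g '' sphere 0 1 := by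
    rw [hD, frontier_carrier_image, carrier_unitDisc, frontier_ball _ one_ne_zero]
  have hg2 : ∀ z ∈ closedBall (0 : ℂ) 1, g z ∈ ball (0 : ℂ) 2 := fun z hz =>
    (hcb (ha_mem z (mem_closedBall_zero_iff.1 hz))).2
  have hgsrc : ∀ z ∈ closedBall (0 : ℂ) 1, g z ∈ ψ.source := fun z hz =>
    ψ.map_target (hcb (ha_mem z (mem_closedBall_zero_iff.1 hz))).1
  have hDball : closure D.carrier ⊆ ball 0 2 := by
    rw [hDcl]; rintro _ ⟨z, hz, rfl⟩; exact hg2 z hz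
  -- the homeomorphism extending `g` (or `g ∘ conj`) by the identity outside the disc of radius 2
  obtain ⟨H, hHid, hHg, hHcl, hHball⟩ := exists_homeomorph_extend_closedBall D hDball hgc
    (hDcl ▸ hgi.bijOn_image) (by rw [hDc]; exact fun z hz => mem_image_of_mem g hz)
    (by rw [hDfr]; exact fun z hz => mem_image_of_mem g hz)
  refine ⟨H, hHid, ?_, ?_⟩
  · -- over the unit disc, `ψ ∘ H` is the affine map `a` (or `a ∘ conj`)
    have hP : ball (0 : ℂ) 1 ⊆ H.toOpenPartialHomeomorph.source := fun _ _ => trivial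
    have hPψ : H.toOpenPartialHomeomorph '' ball 0 1 ⊆ ψ.source := by
      rintro _ ⟨z, hz, rfl⟩
      show H z ∈ ψ.source
      rcases hHg with h | h
      · rw [h (ball_subset_closedBall hz)]; exact hgsrc z (ball_subset_closedBall hz)
      · rw [h (ball_subset_closedBall hz)]
        exact hgsrc _ (by simpa using ball_subset_closedBall hz)
    refine pullback_agreeOn_stdAtlas 𝒮 hψ H.toOpenPartialHomeomorph isOpen_ball hP hPψ ?_
    -- the two cases `H = g`, `H = g ∘ conj` on the closed unit disc
    obtain ⟨σ, hσc, hσc', hσn, hσσ, hHσ⟩ : ∃ σ : ℂ → ℂ, ContDiff ℝ ∞ σ ∧ Continuous σ ∧ (∀ z, ‖σ z‖ = ‖z‖) ∧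
        (∀ z, σ (σ z) = z) ∧ EqOn H (g ∘ σ) (closedBall 0 1) := by
      rcases hHg with h | h
      · exact ⟨id, contDiff_id, continuous_id, fun z => rfl, fun z => rfl, h⟩
      · exact ⟨starRingEnd ℂ, contDiff_conj, Complex.continuous_conj, fun z => Complex.norm_conj z,
          fun z => Complex.conj_conj z, h⟩
    set m := (H.toOpenPartialHomeomorph ≫ₕ ψ).restr (ball 0 1) with hm
    have hmsrc : m.source = ball 0 1 := by
      rw [hm, restr_source' _ _ isOpen_ball, trans_source]
      ext z; constructor
      · exact fun hz => hz.2
      · intro hz; exact ⟨⟨trivial, hPψ (mem_image_of_mem _ hz)⟩, hz⟩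
    have hm_apply : ∀ z ∈ ball (0 : ℂ) 1, m z = a (σ z) := fun z hz => by
      show ψ (H z) = a (σ z)
      rw [hHσ (ball_subset_closedBall hz), Function.comp_apply, hg]
      exact ψ.right_inv (hcb (ha_mem _ (by rw [hσn]; exact (mem_ball_zero_iff.1 hz).le))).1
    have hmtgt : m.target = a '' (σ '' ball 0 1) := by
      rw [← m.image_source_eq_target, hmsrc, image_image]
      exact image_congr fun z hz => hm_apply z hz
    -- the inverse of `m` on its target
    set b : 𝔼₂ → ℂ := fun x => σ (cι.symm ((ρ : ℝ)⁻¹ • (x - c))) with hb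
    have hbc : ContDiff ℝ ∞ b := by
      rw [hb]
      exact hσc.comp (cι.symm.contDiff.comp ((contDiff_id.sub contDiff_const).const_smul ρ⁻¹))
    have hba : ∀ z, b (a z) = σ z := fun z => by
      simp only [hb, ha, add_sub_cancel_left, smul_smul, inv_mul_cancel₀ hρ0.ne', one_smul,
        ContinuousLinearEquiv.symm_apply_apply]
    have hm_symm : ∀ x ∈ m.target, m.symm x = b x := fun x hx => by
      rw [hmtgt] at hx
      obtain ⟨_, ⟨z, hz, rfl⟩, rfl⟩ := hx
      rw [← hm_apply z hz, m.left_inv (by rw [hmsrc]; exact hz), hm_apply z hz, hba, hσσ]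
    have hac'' : ContDiff ℝ ∞ a := by
      rw [ha]; exact contDiff_const.add (cι.contDiff.const_smul ρ)
    have hac' : ContDiff ℝ ∞ (a ∘ σ) := hac''.comp hσc
    refine ⟨?_, ?_⟩
    · rw [hmsrc]
      exact hac'.contDiffOn.congr fun z hz => hm_apply z hz
    · exact hbc.contDiffOn.congr fun x hx => hm_symm x hx
  · refine pullback_agreeOn_of_eqOn_id 𝒮 H.toOpenPartialHomeomorph isClosed_closedBall.isOpen_compl
      (fun _ _ => trivial) fun z hz => ?_
    have hz2 : 2 ≤ ‖z‖ := by
      simp only [mem_compl_iff, mem_closedBall_zero_iff, not_le] at hz; exact hz.le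
    exact hHid z hz2

end Literature.Topology.FourManifolds

end

noncomputable section

namespace Literature.Topology.FourManifolds

open Set Metric OpenPartialHomeomorph Filter
open scoped Manifold _root_.Topology ContDiff
open Literature.Geometry.Manifold (AtlasOn)
open Literature.Geometry.Manifold.AtlasOn
open Literature.Probability.RandomPlanarGeometry (JordanDomain)
open Literature.Probability.RandomPlanarGeometry.JordanDomain
open Literature.Topology.PlaneTopology

/-- Local notation for the model plane `ℝ²`. -/
local notation "𝔼₂" => EuclideanSpace ℝ (Fin 2)

/-! ### Uniformising a pair of nested Jordan domains by the round pair, smoothly on the inner one -/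

/-- `h⁻¹ (h s) = s` for a homeomorphism (image form). [folklore] -/
theorem homeomorph_symm_image_image {X Y : Type*} [TopologicalSpace X] [TopologicalSpace Y]
    (h : X ≃ₜ Y) (s : Set X) : h.symm '' (h '' s) = s := by
  rw [image_image]; simp

/-- `h ⁻¹' (h '' s) = s` for a homeomorphism. [folklore] -/
theorem homeomorph_preimage_image {X Y : Type*} [TopologicalSpace X] [TopologicalSpace Y]
    (h : X ≃ₜ Y) (s : Set X) : h ⁻¹' (h '' s) = s :=
  h.injective.preimage_image s

/-- Holomorphic maps on open sets are real `C^∞`. [folklore] -/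
theorem contDiffOn_real_of_differentiableOn {f : ℂ → ℂ} {U : Set ℂ} (hU : IsOpen U)
    (hf : DifferentiableOn ℂ f U) : ContDiffOn ℝ ∞ f U :=
  ((hf.contDiffOn hU (n := ∞)).restrict_scalars ℝ)

/-- **A nested pair of Jordan domains is the image of the round pair `{‖z‖ < 1} ⊆ {‖z‖ < 2}`
under a homeomorphism of `ℂ` which is a `C^∞` diffeomorphism of the inner domain onto the unit
disc** (Riemann mapping + Carathéodory on the inner domain, the annulus theorem in between, a
Schoenflies homeomorphism outside; the inner uniformisation is the Riemann map, possibly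
followed by complex conjugation to match orientations). [folklore] -/
theorem exists_homeomorph_uniformize_pair (P₁ P₂ : JordanDomain) (h : closure P₁.carrier ⊆ P₂.carrier) :
    ∃ T : ℂ ≃ₜ ℂ, T '' P₁.carrier = ball 0 1 ∧ T '' closure P₁.carrier = closedBall 0 1 ∧
      T '' P₂.carrier = ball 0 2 ∧ T '' closure P₂.carrier = closedBall 0 2 ∧
      ContDiffOn ℝ ∞ T P₁.carrier ∧ ContDiffOn ℝ ∞ T.symm (ball 0 1) := by
  classical
  -- Carathéodory charts of the two domains
  obtain ⟨z₁, hz₁⟩ := P₁.nonempty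
  obtain ⟨C₁, -⟩ := P₁.exists_discChart_apply_eq hz₁
  obtain ⟨z₂, hz₂⟩ := P₂.nonempty
  obtain ⟨C₂, -⟩ := P₂.exists_discChart_apply_eq hz₂
  -- boundary parametrisations
  have hg₁c : ContinuousOn C₁.Φ (sphere 0 1) := C₁.continuousOn.mono sphere_subset_closedBall
  set g₂ : ℂ → ℂ := fun z => C₂.Φ (z / 2) with hg₂
  have hhalf : ∀ z ∈ sphere (0 : ℂ) 2, z / 2 ∈ sphere (0 : ℂ) 1 := fun z hz => by
    rw [mem_sphere_zero_iff_norm] at hz ⊢; rw [norm_div, hz]; norm_num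
  have hg₂c : ContinuousOn g₂ (sphere 0 2) :=
    C₂.continuousOn.comp (continuous_id.div_const _).continuousOn fun z hz =>
      sphere_subset_closedBall (hhalf z hz)
  have hg₂b : BijOn g₂ (sphere 0 2) (frontier P₂.carrier) := by
    have himg : (fun z : ℂ => z / 2) '' sphere 0 2 = sphere 0 1 := by
      ext w; simp only [mem_image, mem_sphere_zero_iff_norm]
      constructor
      · rintro ⟨z, hz, rfl⟩; rw [norm_div, hz]; norm_num
      · intro hw; exact ⟨2 * w, by rw [norm_mul, hw]; norm_num, by ring⟩
    have hinj : InjOn (fun z : ℂ => z / 2) (sphere 0 2) := fun a _ b _ hab => by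
      have : a / 2 = b / 2 := hab
      linear_combination 2 * this
    have := C₂.bijOn_sphere.comp (himg ▸ hinj.bijOn_image)
    exact this
  obtain ⟨H, -, hH₁, hb1, hs1, hb2, hs2, hext⟩ := annulus_theorem h hg₁c C₁.bijOn_sphere hg₂c hg₂b
  -- the inner map `G = C₁.Φ` or `C₁.Φ ∘ conj`, holomorphic or antiholomorphic inside
  obtain ⟨σ, hσc, hσn, hσσ, hHG⟩ : ∃ σ : ℂ → ℂ, ContDiff ℝ ∞ σ ∧ (∀ z, ‖σ z‖ = ‖z‖) ∧ (∀ z, σ (σ z) = z) ∧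
      EqOn H (C₁.Φ ∘ σ) (sphere 0 1) := by
    rcases hH₁ with h' | h'
    · exact ⟨id, contDiff_id, fun z => rfl, fun z => rfl, h'⟩
    · exact ⟨starRingEnd ℂ, contDiff_conj, fun z => Complex.norm_conj z, fun z => Complex.conj_conj z, h'⟩
  set G : ℂ → ℂ := C₁.Φ ∘ σ with hG
  have hσball : ∀ z, z ∈ ball (0 : ℂ) 1 ↔ σ z ∈ ball (0 : ℂ) 1 := fun z => by simp [hσn]
  have hσcb : ∀ z, z ∈ closedBall (0 : ℂ) 1 ↔ σ z ∈ closedBall (0 : ℂ) 1 := fun z => by simp [hσn]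
  have hσbij : BijOn σ (closedBall 0 1) (closedBall 0 1) :=
    ⟨fun z hz => (hσcb z).1 hz, fun a _ b _ hab => by rw [← hσσ a, hab, hσσ],
      fun z hz => ⟨σ z, (hσcb z).1 hz, hσσ z⟩⟩
  have hGc : ContinuousOn G (closedBall 0 1) := C₁.continuousOn.comp hσc.continuous.continuousOn fun z hz => (hσcb z).1 hz
  have hGbij : BijOn G (closedBall 0 1) (closure P₁.carrier) := C₁.bijOn.comp hσbij
  have hGball : G '' ball 0 1 = P₁.carrier := by
    have : σ '' ball 0 1 = ball 0 1 := by
      ext w; constructor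
      · rintro ⟨z, hz, rfl⟩; exact (hσball z).1 hz
      · intro hw; exact ⟨σ w, (hσball w).1 hw, hσσ w⟩
    rw [hG, image_comp, this]; exact C₁.bijOn_ball.image_eq
  have hGsph : G '' sphere 0 1 = frontier P₁.carrier := by
    have : σ '' sphere 0 1 = sphere 0 1 := by
      ext w; simp only [mem_image, mem_sphere_zero_iff_norm]
      constructor
      · rintro ⟨z, hz, rfl⟩; rw [hσn, hz]
      · intro hw; exact ⟨σ w, by rw [hσn, hw], hσσ w⟩
    rw [hG, image_comp, this]; exact C₁.bijOn_sphere.image_eq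
  -- paste `G` on the closed unit disc with `H` outside the unit disc
  have hHcb : H '' closedBall 0 1 = closure P₁.carrier := by
    rw [← ball_union_sphere, image_union, hb1, hs1, closure_eq_self_union_frontier]
  have hHcompl : H '' (ball 0 1)ᶜ = (P₁.carrier)ᶜ := by rw [image_compl_eq H.bijective, hb1]
  set S : ℂ → ℂ := (closedBall (0 : ℂ) 1).piecewise G H with hS
  have hagree : EqOn G H (closedBall 0 1 ∩ (ball 0 1)ᶜ) := by
    rintro z ⟨hz, hz'⟩
    have hzs : z ∈ sphere (0 : ℂ) 1 := by
      rw [mem_sphere_zero_iff_norm]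
      exact le_antisymm (mem_closedBall_zero_iff.1 hz) (not_lt.1 fun h' => hz' (mem_ball_zero_iff.2 h'))
    exact (hHG hzs).symm
  have hcover : closedBall (0 : ℂ) 1 ∪ (ball 0 1)ᶜ = univ :=
    eq_univ_of_forall fun z => by
      by_cases hz : z ∈ ball (0 : ℂ) 1
      · exact Or.inl (ball_subset_closedBall hz)
      · exact Or.inr hz
  have hcoverT : closure P₁.carrier ∪ (P₁.carrier)ᶜ = univ :=
    eq_univ_of_forall fun z => by
      by_cases hz : z ∈ P₁.carrier
      · exact Or.inl (subset_closure hz)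
      · exact Or.inr hz
  have hbijS : BijOn S univ univ := by
    have key : BijOn S (closedBall 0 1 ∪ (ball 0 1)ᶜ) (closure P₁.carrier ∪ (P₁.carrier)ᶜ) := by
      refine bijOn_piecewise hGbij (hHcompl ▸ H.injective.injOn.bijOn_image) hagree ?_
      rintro y ⟨hy, hy'⟩
      have hyfr : y ∈ frontier P₁.carrier := by
        rw [frontier_eq_closure_inter_closure, P₁.isOpen.isClosed_compl.closure_eq]; exact ⟨hy, hy'⟩
      rw [← hGsph] at hyfr
      obtain ⟨z, hz, rfl⟩ := hyfr
      exact ⟨z, ⟨sphere_subset_closedBall hz, fun h' => by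
        rw [mem_sphere_zero_iff_norm] at hz; rw [mem_ball_zero_iff] at h'; linarith⟩, rfl⟩
    rwa [hcover, hcoverT] at key
  have hcontS : Continuous S := by
    rw [← continuousOn_univ, ← hcover]
    exact continuousOn_piecewise_of_isClosed isClosed_closedBall isOpen_ball.isClosed_compl hGc
      H.continuous.continuousOn hagree
  have hS_out : ∀ z, z ∉ closedBall (0 : ℂ) 1 → S z = H z := fun z hz => piecewise_eq_of_notMem _ _ _ hz
  have hS_in : ∀ z ∈ closedBall (0 : ℂ) 1, S z = G z := fun z hz => piecewise_eq_of_mem _ _ _ hz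
  have hprop : Tendsto S (cocompact ℂ) (cocompact ℂ) := by
    refine Filter.tendsto_cocompact_cocompact_of_norm fun ε => ?_
    have hK : IsCompact (H ⁻¹' closedBall 0 ε) := H.isCompact_preimage.2 (isCompact_closedBall 0 ε)
    obtain ⟨r₀, hr₀⟩ := hK.isBounded.subset_ball 0
    refine ⟨max r₀ 1, fun z hz => ?_⟩
    have hz1 : z ∉ closedBall (0 : ℂ) 1 := fun h' => by
      have := mem_closedBall_zero_iff.1 h'; linarith [le_max_right r₀ 1]
    rw [hS_out z hz1]
    by_contra hle
    push Not at hle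
    have : z ∈ ball (0 : ℂ) r₀ := hr₀ (mem_closedBall_zero_iff.2 hle)
    rw [mem_ball_zero_iff] at this; linarith [le_max_left r₀ 1]
  have hShomeo : IsHomeomorph S :=
    isHomeomorph_iff_continuous_isClosedMap_bijective.2 ⟨hcontS,
      (isProperMap_iff_tendsto_cocompact.2 ⟨hcontS, hprop⟩).isClosedMap, bijOn_univ.1 hbijS⟩
  set Sh : ℂ ≃ₜ ℂ := hShomeo.homeomorph S with hSh
  have hSh_apply : ∀ z, Sh z = S z := fun z => rfl
  -- images under `S`
  have hS_ball : Sh '' ball 0 1 = P₁.carrier := by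
    rw [← hGball]; exact image_congr fun z hz => hS_in z (ball_subset_closedBall hz)
  have hS_cb : Sh '' closedBall 0 1 = closure P₁.carrier := by
    rw [← hGbij.image_eq]; exact image_congr fun z hz => hS_in z hz
  have hS_eq_H : ∀ X : Set ℂ, closedBall 0 1 ⊆ X → Sh '' X = H '' X := by
    intro X hX
    have hXeq : X = closedBall 0 1 ∪ (X \ closedBall 0 1) := by
      rw [union_sdiff_self, union_eq_self_of_subset_left hX]
    rw [hXeq, image_union, image_union, hS_cb, ← hHcb]
    congr 1
    exact image_congr fun z hz => hS_out z hz.2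
  have h12 : closedBall (0 : ℂ) 1 ⊆ ball 0 2 := closedBall_subset_ball (by norm_num)
  have hS_ball2 : Sh '' ball 0 2 = P₂.carrier := by rw [hS_eq_H _ h12, hb2]
  have hS_cb2 : Sh '' closedBall 0 2 = closure P₂.carrier := by
    rw [hS_eq_H _ (h12.trans ball_subset_closedBall), ← ball_union_sphere, image_union, hb2, hs2,
      closure_eq_self_union_frontier]
  -- `T = S⁻¹`
  refine ⟨Sh.symm, ?_, ?_, ?_, ?_, ?_, ?_⟩
  · rw [← hS_ball, homeomorph_symm_image_image]
  · rw [← hS_cb, homeomorph_symm_image_image]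
  · rw [← hS_ball2, homeomorph_symm_image_image]
  · rw [← hS_cb2, homeomorph_symm_image_image]
  · -- on `P₁`, `S⁻¹ = σ ∘ φ₁⁻¹`
    have hinv : ∀ z ∈ P₁.carrier, Sh.symm z = σ (C₁.φ.symm z) := fun z hz => by
      apply Sh.injective
      rw [Sh.apply_symm_apply, hSh_apply]
      have hu : C₁.φ.symm z ∈ ball (0 : ℂ) 1 := C₁.φ.symm_mapsTo hz
      have hu' : σ (C₁.φ.symm z) ∈ closedBall (0 : ℂ) 1 := (hσcb _).1 (ball_subset_closedBall hu)
      rw [hS_in _ hu', hG, Function.comp_apply, hσσ, C₁.eqOn hu, C₁.φ.apply_symm_apply hz]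
    refine (hσc.comp_contDiffOn ?_).congr hinv
    exact contDiffOn_real_of_differentiableOn P₁.isOpen C₁.φ.symm.differentiableOn_coe
  · -- on the unit disc, `S = φ₁ ∘ σ`
    have hval : ∀ z ∈ ball (0 : ℂ) 1, Sh.symm.symm z = C₁.φ (σ z) := fun z hz => by
      rw [Homeomorph.symm_symm, hSh_apply, hS_in z (ball_subset_closedBall hz), hG, Function.comp_apply,
        C₁.eqOn ((hσball z).1 hz)]
    refine ContDiffOn.congr ?_ hval
    refine (contDiffOn_real_of_differentiableOn isOpen_ball C₁.φ.differentiableOn_coe).comp hσc.contDiffOn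
      fun z hz => (hσball z).1 hz

/-! ### Straightening over an arbitrary Jordan domain -/

/-- Pulling back the standard structure along a homeomorphism which is a diffeomorphism on an
open set `O'` (onto its image inside `O`) gives the standard structure over `O'`. [folklore] -/
theorem pullback_stdAtlas_agreeOn {O O' : Set ℂ} (hO : IsOpen O) (hO' : IsOpen O') (T : ℂ ≃ₜ ℂ)
    (hTO : T '' O' ⊆ O) (hT : ContDiffOn ℝ ∞ T O') (hTs : ContDiffOn ℝ ∞ T.symm (T '' O')) :
    ((stdAtlas O hO).pullback T.toOpenPartialHomeomorph).AgreeOn (stdAtlas O' hO') O' := by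
  refine agreeOn_stdAtlas_of_isSmoothChart _ hO' ?_
  rintro _ ⟨e, he, rfl⟩
  rw [stdAtlas_charts, mem_singleton_iff] at he
  subst he
  -- the chart `(T ≫ stdChart|O)|O' = cι ∘ T` on `O'`
  have hsrc : ((T.toOpenPartialHomeomorph ≫ₕ stdChart.restr O).restr O').source = O' := by
    rw [restr_source' _ _ hO', trans_source, restr_source' _ _ hO]
    ext z; simp only [Homeomorph.toOpenPartialHomeomorph_source, stdChart_source, univ_inter, mem_inter_iff,
      mem_preimage, Homeomorph.toOpenPartialHomeomorph_apply]
    exact ⟨fun hz => hz.2, fun hz => ⟨hTO (mem_image_of_mem T hz), hz⟩⟩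
  refine ⟨?_, ?_⟩
  · rw [hsrc]
    exact (cι.contDiff.comp_contDiffOn hT).congr fun z _ => rfl
  · have htgt : ((T.toOpenPartialHomeomorph ≫ₕ stdChart.restr O).restr O').target = cι '' (T '' O') := by
      rw [← image_source_eq_target, hsrc, image_image]; rfl
    rw [htgt]
    have : ContDiffOn ℝ ∞ (T.symm ∘ cι.symm) (cι '' (T '' O')) := by
      refine hTs.comp cι.symm.contDiff.contDiffOn fun x hx => ?_
      obtain ⟨y, hy, rfl⟩ := hx
      simpa using hy
    exact this.congr fun x _ => rfl

/-- Pull-back along the identity homeomorphism does not change the charts. [folklore] -/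
theorem pullback_refl_charts {W : Set ℂ} (𝒮 : PlaneAtlas W) :
    (𝒮.pullback (Homeomorph.refl ℂ).toOpenPartialHomeomorph).charts = 𝒮.charts := by
  rw [pullback_charts, Homeomorph.refl_toOpenPartialHomeomorph]
  have : (fun e : OpenPartialHomeomorph ℂ (EuclideanSpace ℝ (Fin 2)) => OpenPartialHomeomorph.refl ℂ ≫ₕ e) = id := by
    funext e; exact OpenPartialHomeomorph.refl_trans e
  rw [this, image_id]

/-- **Straightening a smooth structure over a Jordan domain** (the `0`-handle smoothing lemma for
an arbitrary closed Jordan disc): if `𝒮` is a smooth atlas on an open `W ⊆ ℂ` and `P₁ ⊆ P₂` are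
Jordan domains with `closure P₁ ⊆ P₂`, `closure P₂ ⊆ W`, there is a homeomorphism `Φ` of `ℂ`,
the identity off `closure P₂`, such that `Φ*𝒮` is the standard structure over `P₁` and agrees
with `𝒮` off `closure P₂`. (Uniformise the pair by `exists_homeomorph_uniformize_pair` and apply
the round case `exists_homeomorph_pullback_agreeOn_stdAtlas` to the transported structure.)
[folklore] -/
theorem exists_homeomorph_pullback_agreeOn_stdAtlas_jordan {W : Set ℂ} (𝒮 : PlaneAtlas W)
    (P₁ P₂ : JordanDomain) (h12 : closure P₁.carrier ⊆ P₂.carrier) (h2W : closure P₂.carrier ⊆ W) :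
    ∃ Φ : ℂ ≃ₜ ℂ, (∀ z ∉ closure P₂.carrier, Φ z = z) ∧ Φ '' closure P₂.carrier = closure P₂.carrier ∧
      (𝒮.pullback Φ.toOpenPartialHomeomorph).AgreeOn (stdAtlas P₁.carrier P₁.isOpen) P₁.carrier ∧
      (𝒮.pullback Φ.toOpenPartialHomeomorph).AgreeOn 𝒮 (closure P₂.carrier)ᶜ := by
  obtain ⟨T, hT1, hT1c, hT2, hT2c, hTs, hTs'⟩ := exists_homeomorph_uniformize_pair P₁ P₂ h12
  -- the transported structure on `T '' W ⊇ closedBall 0 2`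
  set 𝒮T := 𝒮.pullback T.symm.toOpenPartialHomeomorph with h𝒮T
  have hTW : closedBall (0 : ℂ) 2 ⊆ T.symm.toOpenPartialHomeomorph.source ∩ T.symm.toOpenPartialHomeomorph ⁻¹' W := by
    intro z hz
    refine ⟨trivial, ?_⟩
    show T.symm z ∈ W
    rw [← hT2c] at hz
    obtain ⟨w, hw, rfl⟩ := hz
    rw [T.symm_apply_apply]; exact h2W hw
  obtain ⟨Φ₀, hΦ₀id, hΦ₀std, hΦ₀far⟩ := exists_homeomorph_pullback_agreeOn_stdAtlas 𝒮T hTW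
  set Φ : ℂ ≃ₜ ℂ := T.trans (Φ₀.trans T.symm) with hΦ
  have hΦ_apply : ∀ z, Φ z = T.symm (Φ₀ (T z)) := fun z => rfl
  -- the charts of `Φ*𝒮` are those of `T*(Φ₀*(𝒮T))`
  have hcharts : (𝒮.pullback Φ.toOpenPartialHomeomorph).charts =
      ((𝒮T.pullback Φ₀.toOpenPartialHomeomorph).pullback T.toOpenPartialHomeomorph).charts := by
    rw [pullback_pullback_charts, pullback_pullback_charts, hΦ, Homeomorph.trans_toOpenPartialHomeomorph,
      Homeomorph.trans_toOpenPartialHomeomorph, trans_assoc]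
  refine ⟨Φ, fun z hz => ?_, ?_, ?_, ?_⟩
  · rw [hΦ_apply]
    have hTz : 2 ≤ ‖T z‖ := by
      by_contra hlt
      push Not at hlt
      have : T z ∈ closedBall (0 : ℂ) 2 := mem_closedBall_zero_iff.2 hlt.le
      rw [← hT2c] at this
      obtain ⟨w, hw, hwz⟩ := this
      exact hz (T.injective hwz ▸ hw)
    rw [hΦ₀id _ hTz, T.symm_apply_apply]
  · -- `Φ` preserves `closure P₂ = T⁻¹ (closedBall 0 2)` since `Φ₀` preserves the closed ball
    have hΦ₀cb : Φ₀ '' closedBall 0 2 = closedBall 0 2 := by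
      -- `Φ₀` is the identity on the sphere and a bijection; it maps the complement of the closed
      -- ball to itself, hence the closed ball to itself
      have hout : Φ₀ '' (closedBall 0 2)ᶜ = (closedBall 0 2)ᶜ := by
        have h1 : ∀ z ∈ (closedBall (0 : ℂ) 2)ᶜ, Φ₀ z = z := fun z hz => by
          simp only [mem_compl_iff, mem_closedBall_zero_iff, not_le] at hz
          exact hΦ₀id z hz.le
        rw [image_congr h1, image_id']
      have := congrArg compl (Φ₀.image_compl (closedBall 0 2) ▸ hout)
      simpa using this
    show Φ '' closure P₂.carrier = closure P₂.carrier
    have : (Φ : ℂ → ℂ) = T.symm ∘ Φ₀ ∘ T := rfl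
    rw [this, image_comp, image_comp, hT2c, hΦ₀cb, ← hT2c, homeomorph_symm_image_image]
  · rw [agreeOn_iff_of_charts_eq hcharts rfl]
    -- pull the round statement back along `T` and compare with the standard atlas on `P₁`
    have h1 := hΦ₀std.pullback isOpen_ball T.toOpenPartialHomeomorph
    have hset : T.toOpenPartialHomeomorph.source ∩ T.toOpenPartialHomeomorph ⁻¹' ball 0 1 = P₁.carrier := by
      rw [Homeomorph.toOpenPartialHomeomorph_source, univ_inter]
      show T ⁻¹' ball 0 1 = P₁.carrier
      rw [← hT1, homeomorph_preimage_image]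
    have hopen : IsOpen (T.toOpenPartialHomeomorph.source ∩ T.toOpenPartialHomeomorph ⁻¹' ball 0 1) := by
      rw [hset]; exact P₁.isOpen
    have h1' := h1.mono hopen P₁.isOpen hset.symm.le
    have h2 : ((stdAtlas (ball 0 1) isOpen_ball).pullback T.toOpenPartialHomeomorph).AgreeOn
        (stdAtlas P₁.carrier P₁.isOpen) P₁.carrier :=
      pullback_stdAtlas_agreeOn isOpen_ball P₁.isOpen T hT1.le hTs (by rwa [hT1])
    have h3 := h1'.trans h2 P₁.isOpen
    exact h3.mono (P₁.isOpen.inter hopen) P₁.isOpen fun z hz => ⟨hz, hset.symm ▸ hz⟩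
  · rw [agreeOn_iff_of_charts_eq hcharts rfl]
    have h1 := hΦ₀far.pullback isClosed_closedBall.isOpen_compl T.toOpenPartialHomeomorph
    have hset : T.toOpenPartialHomeomorph.source ∩ T.toOpenPartialHomeomorph ⁻¹' (closedBall 0 2)ᶜ =
        (closure P₂.carrier)ᶜ := by
      rw [Homeomorph.toOpenPartialHomeomorph_source, univ_inter, preimage_compl]
      show (T ⁻¹' closedBall 0 2)ᶜ = (closure P₂.carrier)ᶜ
      rw [← hT2c, homeomorph_preimage_image]
    have hopen : IsOpen (T.toOpenPartialHomeomorph.source ∩ T.toOpenPartialHomeomorph ⁻¹' (closedBall 0 2)ᶜ) := by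
      rw [hset]; exact isClosed_closure.isOpen_compl
    have h1' := h1.mono hopen isClosed_closure.isOpen_compl hset.symm.le
    -- `T*(𝒮T) = 𝒮`
    have hcharts' : (𝒮T.pullback T.toOpenPartialHomeomorph).charts = 𝒮.charts := by
      rw [h𝒮T, pullback_pullback_charts, ← Homeomorph.trans_toOpenPartialHomeomorph, Homeomorph.self_trans_symm,
        pullback_refl_charts]
    exact (agreeOn_iff_of_charts_eq rfl hcharts' _).1 h1'

end Literature.Topology.FourManifolds

end
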